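import Literature.Barriers.Parity.FordMaynardPrimeSievesMinimalTypeII
import Literature.NumberTheory.Sieve.FordMaynardLambdaVec
import Literature.NumberTheory.Sieve.FordMaynardTypeIStarConstruction
import HarnessLib

/-!
# Ford–Maynard §9.2: discharge of `FordMaynardTypeIStarBelowMinusOne`

The named fact `Literature.Barriers.Parity.FordMaynardTypeIStarBelowMinusOne`
(`FordMaynardPrimeSievesMinimalTypeII.lean`; K. Ford, J. Maynard, *On the theory of prime
producing sieves*, arXiv:2407.14368, §9.2 with Lemmas 9.3 and 9.5) is PROVED here:

  for every `1/2 < γ < 1` there are `0 < η < 1 − γ` and `f ∈ 𝔉*_η(γ)` with `f(1) < −1` and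
  `f(β) ≥ −1` for all `β` of dimension `≥ 2`.

The witness is Ford–Maynard's `f = λ̃^{(1−γ,η)} + g/g₀`, `g = (1 − 2^{k−3}) λ̃^{(c,ε)}`,
`c = (1−γ)/2`, realised as `FordMaynard.fmF γ` (`FordMaynardTypeIStarConstruction.lean`, where the
parameters `ε = epsP γ`, `g₀ = gZero γ`, `η = etaP γ` are fixed and the two value statements
`fmF_one_lt : f(1) < −1`, `fmF_ge_neg_one : f ≥ −1` in dimension `≥ 2` are proved from the model
(M-ineq) of `ModifiedLiouville.lean`). Membership `f ∈ 𝔉*_η(γ)` is obtained exactly as printed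
("two applications of Lemma 9.5, with `m = 1` and `m = 2`", and `𝔉*_ε ⊆ 𝔉*_η`): `fmF γ` is the
linear combination `λ₁ + (λ₂^{(1)} − λ₂^{(2)}/8)/g₀` of the Lemma 9.5 functions
`FordMaynard.lamVec` (`fmF_eq_lamVec`), each of which lies in `𝔉*` by
`FordMaynard.memTypeIStar_lamVec` (`FordMaynardLambdaVec.lean`), and `𝔉*_η(γ)` is closed under
such combinations (`MemTypeIStar.add/const_mul/mono`).

## References

* K. Ford, J. Maynard, *On the theory of prime producing sieves*, arXiv:2407.14368v1 (2024), §9.2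
  "The proof of Theorem 9.1['s hypothesis]" (chunk 53 of `lit read arxiv:2407.14368`), Lemma 9.5,
  Lemma 9.3 (M-ineq). [FordMaynard2024PrimeSieves]
-/

noncomputable section

open Finset Literature.Analysis.Convolution

namespace Literature.Barriers.Parity

open Literature.NumberTheory.Sieve Literature.NumberTheory.Sieve.FordMaynard

/-- Ford–Maynard's `f` of §9.2 is the combination `λ₁ + (λ₂^{(1)} − λ₂^{(2)}/8)/g₀` of the
Lemma 9.5 functions `m^k λ̃^{(c,η)}` (`lamVec`): `λ₁ = lamVec η (1−γ) 1`,
`λ₂^{(m)} = lamVec ε ((1−γ)/2) m`, since `(1 − 2^{k−3}) λ̃ = λ̃ − 2^k λ̃/8`.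
[cite: FordMaynard2024PrimeSieves, §9.2 ("Two applications of Lemma 9.5, one with m=1 and the other with m=2")] -/
theorem FordMaynard.fmF_eq_lamVec {γ : ℝ} (hγ1 : γ < 1) :
    fmF γ = fun k x => lamVec (etaP γ) (cOne γ) 1 k x +
      1 / gZero γ * (lamVec (epsP γ) (cTwo γ) 1 k x + -1 / 8 * lamVec (epsP γ) (cTwo γ) 2 k x) := by
  funext k x
  by_cases hs : ∑ i, x i = 1
  · have hf : fmF γ k x =
        (∏ i, MOne γ (x i)) + (1 - (2 : ℝ) ^ k / 8) * (∏ i, MTwo γ (x i)) / gZero γ := if_pos hs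
    have h1 : lamVec (etaP γ) (cOne γ) 1 k x = ∏ i, MOne γ (x i) := by
      by_cases hη : ∀ i, etaP γ ≤ x i
      · rw [lamVec_eq_of ⟨hη, hs⟩]
        simp [MOne]
      · push Not at hη
        obtain ⟨i, hi⟩ := hη
        rw [lamVec_eq_zero_of_not (fun h => absurd (h.1 i) (not_le.2 hi)),
          Finset.prod_eq_zero (Finset.mem_univ i) (MOne_of_lt hγ1 hi)]
    have h2 : ∀ m : ℕ, lamVec (epsP γ) (cTwo γ) m k x = (m : ℝ) ^ k * ∏ i, MTwo γ (x i) := by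
      intro m
      by_cases hε : ∀ i, epsP γ ≤ x i
      · rw [lamVec_eq_of ⟨hε, hs⟩]
        rfl
      · push Not at hε
        obtain ⟨i, hi⟩ := hε
        rw [lamVec_eq_zero_of_not (fun h => absurd (h.1 i) (not_le.2 hi)),
          Finset.prod_eq_zero (Finset.mem_univ i) (MTwo_of_lt hγ1 hi), mul_zero]
    rw [hf, h1, h2 1, h2 2]
    push_cast
    ring
  · have hf : fmF γ k x = 0 := if_neg hs
    rw [hf, lamVec_eq_zero_of_not (fun h => hs h.2), lamVec_eq_zero_of_not (fun h => hs h.2),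
      lamVec_eq_zero_of_not (fun h => hs h.2)]
    ring

/-- **`f ∈ 𝔉*_η(γ)`** for Ford–Maynard's `f` of §9.2 (`1/2 < γ < 1`, `η = etaP γ`): two
applications of Lemma 9.5 (`memTypeIStar_lamVec` with `m = 1, 2` for `λ̃^{(c,ε)}`, `c = (1−γ)/2`,
`2c = 1 − γ`), one for `λ̃^{(1−γ,η)}` (`m = 1`), the inclusion `𝔉*_ε ⊆ 𝔉*_η` (`η < ε`), and the
closure of `𝔉*_η(γ)` under linear combinations. [cite: FordMaynard2024PrimeSieves, §9.2] -/
theorem FordMaynard.memTypeIStar_fmF {γ : ℝ} (hγ : 1 / 2 < γ) (hγ1 : γ < 1) :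
    MemTypeIStar (etaP γ) γ (fmF γ) := by
  have hη := etaP_pos hγ1
  have hε := epsP_pos hγ1
  have hA : MemTypeIStar (etaP γ) γ (lamVec (etaP γ) (cOne γ) 1) :=
    memTypeIStar_lamVec hη (three_mul_etaP_le hγ hγ1) (cOne_le_one hγ) hγ1
      (by simp only [Nat.cast_one, one_mul, cOne, le_refl])
  have hB : MemTypeIStar (etaP γ) γ (lamVec (epsP γ) (cTwo γ) 1) :=
    (memTypeIStar_lamVec hε (three_mul_epsP_le hγ hγ1) (cTwo_le_one hγ) hγ1
      (by simp only [Nat.cast_one, one_mul, cTwo]; linarith)).mono (etaP_lt_epsP hγ1).le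
  have hC : MemTypeIStar (etaP γ) γ (lamVec (epsP γ) (cTwo γ) 2) :=
    (memTypeIStar_lamVec hε (three_mul_epsP_le hγ hγ1) (cTwo_le_one hγ) hγ1
      (by rw [Nat.cast_ofNat, two_mul_cTwo]; exact le_of_eq rfl)).mono (etaP_lt_epsP hγ1).le
  have hmA := measurable_lamVec hη (cOne γ) 1
  have hmB := measurable_lamVec hε (cTwo γ) 1
  have hmC := measurable_lamVec hε (cTwo γ) 2
  rw [fmF_eq_lamVec hγ1]
  exact hA.add hη ((hB.add hη (hC.const_mul (-1 / 8)) hmB fun k => (hmC k).const_mul _).const_mul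
    (1 / gZero γ)) hmA fun k => ((hmB k).add ((hmC k).const_mul _)).const_mul _

/-- **Ford–Maynard, §9.2** (discharge of the named fact `FordMaynardTypeIStarBelowMinusOne`): for
every `1/2 < γ < 1` there are `η` with `0 < η < 1 − γ` and `f ∈ 𝔉*_η(γ)` with `f(1) < −1` and
`f ≥ −1` on all vectors of dimension `≥ 2`; witnesses `η = etaP γ`, `f = fmF γ`.
[cite: FordMaynard2024PrimeSieves, §9.2] [cite: FordMaynard2024PrimeSieves, Lemma 9.5] [cite: FordMaynard2024PrimeSieves, Lemma 9.3] -/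
theorem FordMaynardTypeIStarBelowMinusOne_holds : FordMaynardTypeIStarBelowMinusOne := by
  intro γ hγ hγ1
  refine ⟨etaP γ, etaP_pos hγ1, ?_, fmF γ, FordMaynard.memTypeIStar_fmF hγ hγ1, fmF_one_lt hγ hγ1,
    fun k hk β => fmF_ge_neg_one hγ hγ1 hk β⟩
  have h1 := etaP_lt_epsP hγ1
  have h2 := epsP_le hγ hγ1
  have h3 := cTwo_lt_cOne hγ1
  have h4 : cOne γ = 1 - γ := rfl
  have h5 := cTwo_pos hγ1
  linarith

end Literature.Barriers.Parity
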